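/-
Copyright (c) 2026 the pub-hodgecm-mathlib formalisation cell (harness21).  Prover seat hodgecm-mathlib-LH3-p01 (g7); dealer LH4-plan (g7) WORD #18 «(C6)-5»,
2026-09-02.  Count-neutral reader layer of the dyadic (D-UNR) column (FINDINGS #6∕#6′ of the LH4 board); CENSUS-C6 196c9bc3 §1 row «UnitRow :211∕:497», §3 file 5.
-/
import Literature.NumberTheory.Rogawski1990.DepthZeroKappaTransferTypeOneUnitRowTrace   -- ★ p851796 (P3d): frame∕deep∕regular∕compact-centraliser at the trace literals (+ ★ `…UnitRow`, ★ O8b)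
import HarnessLib

/-!
# The depth-zero κ-transfer, type (1): the UNIT ROW `n₀(t) + n₁(t) + n₂(t) = φ(t)` at the TRACE literals `t_π^{(b)}(x₁,x₂,x₃)` ∕ `t_1^{(b)}(x₁,x₂,x₃)` — NO `2e = 1`, NO `|2| = 1`
# (Rogawski 1990 Prop. 4.9.1; Flicker 1998 Props. 11, 14)

Topic `NumberTheory/Rogawski1990`; namespace `Literature.NumberTheory.Rogawski1990`.  THEOREMS ONLY (no definition, no instance, no notation, no named fact,
no `sorry`); count-neutral; kernel lane `--supports stmt-HodgeConjecture-24833`.  Cell `pub/hodgecm-mathlib`, crux H413 = `stmt-HodgeConjecture-24833`; LH4 board (D-UNR)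
(C6) «the readers in the trace frame» (CENSUS-C6 196c9bc3, LH3-p02 (g6)) file 5, dealer LH4-plan (g7) WORD #18 ∕ #26 ∕ #34 ∕ #35 — VARIANT (A) «OF-COUNT»: the twins of ★
`DepthZeroKappaTransferTypeOneUnitRow` :211 `sum_ncard_rankStrata_eq_phiOne_of_congr` and :497 `…_eq_phiZero_of_congr` (the UNIT ROW of the depth-zero κ-transfer socket) at
the TRACE literals of ★ p851724 ∕ ★ p851796, with the surgery of CENSUS-LAYERB-3of3 4277d501 §3 — `(h2 : IsUnit 2)`, `{e … y}`, `(h2e : 2e = 1)`, `(hy : yσy = −2)` DELETED;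
`{b} (hb : b + σb = 1) (hbv : |b_w| ≤ 1) (hbδ : |σb − b|_w = 1)` ADDED (rulings (R-bv), (R-ord)∕T7) — and with the ONE remaining non-★ input, the (C5)′ EXPORT count
`#Fix_{U(L_w)⧸K}(t) = φ₁(N₁, N)` ∕ `= φ₀(N₁, N₂, N)` at the trace literal (`natCard_fixedPoints_unitaryInt_traceTorus{Pi,}_eq_phi{One,Zero}_adicCompletion`, CENSUS-C5 bd72510a §3,
not yet ★), carried as a TRAILING HYPOTHESIS `hX₁` ∕ `hX₀` in the export binder order of record ((R-ord), WORD #26: `{b}(hb)(hbv)(hbδ){x₁ x₂ x₃ [π π']}(hx₁)(hx₂)(hx₃)[(hσπ)(hππ')(hπN)]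
{t}(hte){N N₁ N₂}(hN)(hN₁)(hN₂)[(htri)](hfin)`, the context-fixed `(w)(hw)[IsAdicComplete](hv)` dropped) — exactly ★ p851882's `hCOne`∕`hCPi` precedent; the CLOSED heads are
the sequel `…UnitRowStrataTraceClosed.lean` (one `exact` each) the day the two exports are ★.  Everything else is ★ and 2-free: regularity ∕ compact centraliser ∕ deepness from
★ p851796 (`…_of_congr_traceTorusElt{Pi,}`), strata exhaustion ★ O8b `sum_range_ncard_strata_eq_ncard_fixedBy`, transport ★ `natCard_fixedBy_cmLocalIntegralLevel_eq_of_congr`,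
finiteness ★ `finite_fixedBy_cmLocalIntegralLevel_iff_of_congr`; the literal is read at `w` through ★ `coe_coe_localNonsplitEquiv_apply` and ★ `conjLocal_apply_eq_of_smul_eq`
(`(σb)_w = σ_w(b_w)`).  Nothing reads `2`, `e`, `y`, `|2|`.  RHS `Flicker1998.phiOne q Q₁ P` ∕ `phiZero q Q₁ Q₂ P` VERBATIM.

HONEST READER LABEL: reader layer MODULO the two (C5)′ export counts (hypotheses `hX₁`∕`hX₀`); HC_CM is proved only modulo the 7 printed citations (2 remaining named inputs:
hLiu418 = stmt-HodgeConjecture-24832, h413 = stmt-HodgeConjecture-24833) until rung 0 closes; count-neutral ((D-UNR) stays PRINT by D74′), pays no organ, opens no road.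

## References
* [Rogawski1990] J. D. Rogawski, *Automorphic Representations of Unitary Groups in Three Variables* (1990), §4.9 Prop. 4.9.1 (b) p. 55, §14.2 p. 233.
* [Flicker1998UnitaryFL] Y. Z. Flicker, *Elementary proof of the fundamental lemma for a unitary group*, Canad. J. Math. 50 (1998), Prop. 11 p. 87, Prop. 14 p. 94, §6 p. 95.
* [Kottwitz1986] R. E. Kottwitz, *Base change for unit elements of Hecke algebras*, Compositio Math. 60 (1986), §3.
-/

set_option autoImplicit false

noncomputable section

open MeasureTheory Measure Set Function NumberField IsDedekindDomain Matrix Polynomial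
open Literature.NumberTheory.Automorphic Literature.NumberTheory.Automorphic.UnitaryGroup
open Literature.NumberTheory.Automorphic.IntegralReduction Literature.NumberTheory.GaloisRepresentations
open Literature.NumberTheory.Automorphic.HermitianLattice (unitaryInt)
open scoped Matrix MatrixGroups ValuativeRel

namespace Literature.NumberTheory.Rogawski1990

/-! ## §1 The unit row at a θ̄ = 1 trace literal `t_π^{(b)}(x₁, x₂, x₃)` -/

section ThetaOne

variable (L : Type) [Field L] [NumberField L] [IsCMField L] (H' : Matrix (Fin 3) (Fin 3) L)
  {v : HeightOneSpectrum (𝓞 ↥(maximalRealSubfield L))}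

set_option synthInstance.maxHeartbeats 200000 in  -- the coset action `U_w ↷ U_w ⧸ unitaryInt` (as in ★ `FixedCosetsTransport`)
open scoped Classical in
/-- **THE UNIT ROW AT A θ̄ = 1 TRACE LITERAL (measure-free)**: for `t ∈ G′_v` congruent to `t_π^{(b)}(x₁,x₂,x₃)` (`b + σb = 1`, `|b_w| ≤ 1`, `ππ′ = 1`, `σπ = π`, `π` a
non-norm) with `x_i` pairwise distinct of norm one and ≡ 1 (mod 𝔪_w), `P = ord_w(x₁ − x₃)`, `Q₁ = ord_w(x₁ − x₂)`: the three residually-unipotent Jordan strata of `Fix_t(G′_v ⧸ K_v)`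
exhaust it and `n₀(t) + n₁(t) + n₂(t) = #Fix_t = φ₁(Q₁, P)` (★ `sum_range_ncard_strata_eq_ncard_fixedBy` ∘ ★ `natCard_fixedBy_cmLocalIntegralLevel_eq_of_congr` ∘ the (C5)′ EXPORT
`natCard_fixedPoints_unitaryInt_traceTorusPi_eq_phiOne_adicCompletion`, here the HYPOTHESIS `hX₁` — variant (A)) — twin of ★ `sum_ncard_rankStrata_eq_phiOne_of_congr` with
`h2 : IsUnit 2`, `h2e : 2e = 1`, `hy : yσy = −2` DELETED (CENSUS-LAYERB-3of3 4277d501 §3 surgery; CENSUS-C6 196c9bc3 row «UnitRow :211»). [cite: Flicker1998UnitaryFL, Prop. 11 p. 87; §6 p. 95]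
[cite: Rogawski1990, §4.9 Prop. 4.9.1 (b) p. 55] [cite: Kottwitz1986, §3] -/
theorem sum_ncard_rankStrata_eq_phiOne_of_congr_traceTorusEltPi_of_count
    (hH' : (H'.map (IsCMField.complexConj L))ᵀ = H') (hH'u : IsUnit H') (w : PlacesOver L v)
    (hw : IsCMField.complexConj L • w.1 = w.1)
    {b π π' x₁ x₂ x₃ : LocalRing L v} (hb : b + conjLocal L (IsCMField.complexConj L) v b = 1) (hbv : Valued.v (b w) ≤ 1)
    (hbδ : Valued.v ((conjLocal L (IsCMField.complexConj L) v b - b) w) = 1)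
    (hσπ : conjLocal L (IsCMField.complexConj L) v π = π) (hππ : π * π' = 1)
    (hπN : ∀ z : LocalRing L v, conjLocal L (IsCMField.complexConj L) v z * z ≠ π)
    (hx₁ : conjLocal L (IsCMField.complexConj L) v x₁ * x₁ = 1) (hx₂ : conjLocal L (IsCMField.complexConj L) v x₂ * x₂ = 1)
    (hx₃ : conjLocal L (IsCMField.complexConj L) v x₃ * x₃ = 1) (h₁₂ : x₁ ≠ x₂) (h₂₃ : x₂ ≠ x₃) (h₁₃ : x₁ ≠ x₃)
    (Tl : GL (Fin 3) (LocalRing L v))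
    (ψ : ↥(UnitaryGroup.«local» L (IsCMField.complexConj L) 3 H' v) ≃ₜ*
        ↥(UnitaryGroup.«local» L (IsCMField.complexConj L) 3 (Matrix.of fun i j : Fin 3 => if i.val + j.val + 1 = 3 then (1 : L) else 0) v))
    (t : (cmDatum L 3 H').Local v)
    (hψ : ∀ g, (ψ g).val = Tl * g.val * Tl⁻¹)
    (hlev : ∀ g, g ∈ cmLocalIntegralLevel L 3 H' v ↔
        ψ g ∈ cmLocalIntegralLevel L 3 (Matrix.of fun i j : Fin 3 => if i.val + j.val + 1 = 3 then (1 : L) else 0) v)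
    (hlit : (ψ t).val.val = !![x₁ * conjLocal L (IsCMField.complexConj L) v b + x₃ * b, 0, π * (x₁ - x₃); 0, x₂, 0;
      π' * (b * conjLocal L (IsCMField.complexConj L) v b * (x₁ - x₃)), 0, x₁ * b + x₃ * conjLocal L (IsCMField.complexConj L) v b])
    {P Q₁ Q₂ : ℕ} (hP : Valued.v (x₁ w - x₃ w) = WithZero.exp (-(P : ℤ))) (hQ₁ : Valued.v (x₁ w - x₂ w) = WithZero.exp (-(Q₁ : ℤ)))
    (hQ₂ : Valued.v (x₃ w - x₂ w) = WithZero.exp (-(Q₂ : ℤ)))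
    (hd₁ : Valued.v (x₁ w - 1) < 1) (hd₂ : Valued.v (x₂ w - 1) < 1) (hd₃ : Valued.v (x₃ w - 1) < 1)
    -- the (C5)′ θ̄ = 1 EXPORT count, carried as a hypothesis ((R-ord) binder order; CENSUS-C5 bd72510a §3 text)
    (hX₁ : ∀ {b₀ : w.1.adicCompletion L}, b₀ + galAdicCompletionMap (L := L) (IsCMField.complexConj L) hw b₀ = 1 → Valued.v b₀ ≤ 1 →
      Valued.v (galAdicCompletionMap (L := L) (IsCMField.complexConj L) hw b₀ - b₀) = 1 →
      ∀ {a₁ a₂ a₃ ϖ₁ ϖ₁' : w.1.adicCompletion L}, galAdicCompletionMap (L := L) (IsCMField.complexConj L) hw a₁ * a₁ = 1 →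
      galAdicCompletionMap (L := L) (IsCMField.complexConj L) hw a₂ * a₂ = 1 → galAdicCompletionMap (L := L) (IsCMField.complexConj L) hw a₃ * a₃ = 1 →
      galAdicCompletionMap (L := L) (IsCMField.complexConj L) hw ϖ₁ = ϖ₁ → ϖ₁ * ϖ₁' = 1 →
      (∀ z : w.1.adicCompletion L, galAdicCompletionMap (L := L) (IsCMField.complexConj L) hw z * z ≠ ϖ₁) →
      ∀ {t₀ : ↥(unitaryGroupOfForm (galAdicCompletionMap (L := L) (IsCMField.complexConj L) hw)
        (placeForm (Matrix.of fun i j : Fin 3 => if i.val + j.val + 1 = 3 then (1 : L) else 0) w.1))},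
      ((t₀ : GL (Fin 3) (w.1.adicCompletion L)) : Matrix (Fin 3) (Fin 3) (w.1.adicCompletion L)) =
        !![a₁ * galAdicCompletionMap (L := L) (IsCMField.complexConj L) hw b₀ + a₃ * b₀, 0, ϖ₁ * (a₁ - a₃); 0, a₂, 0;
          ϖ₁' * (b₀ * galAdicCompletionMap (L := L) (IsCMField.complexConj L) hw b₀ * (a₁ - a₃)), 0,
          a₁ * b₀ + a₃ * galAdicCompletionMap (L := L) (IsCMField.complexConj L) hw b₀] →
      ∀ {N N₁ N₂ : ℕ}, Valued.v (a₁ - a₃) = WithZero.exp (-(N : ℤ)) → Valued.v (a₁ - a₂) = WithZero.exp (-(N₁ : ℤ)) →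
      Valued.v (a₃ - a₂) = WithZero.exp (-(N₂ : ℤ)) →
      {x : ↥(unitaryGroupOfForm (galAdicCompletionMap (L := L) (IsCMField.complexConj L) hw)
          (placeForm (Matrix.of fun i j : Fin 3 => if i.val + j.val + 1 = 3 then (1 : L) else 0) w.1)) ⧸
        unitaryInt (galAdicCompletionMap (L := L) (IsCMField.complexConj L) hw)
          (placeForm (Matrix.of fun i j : Fin 3 => if i.val + j.val + 1 = 3 then (1 : L) else 0) w.1) | t₀ • x = x}.Finite →
      (Nat.card {x : ↥(unitaryGroupOfForm (galAdicCompletionMap (L := L) (IsCMField.complexConj L) hw)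
          (placeForm (Matrix.of fun i j : Fin 3 => if i.val + j.val + 1 = 3 then (1 : L) else 0) w.1)) ⧸
        unitaryInt (galAdicCompletionMap (L := L) (IsCMField.complexConj L) hw)
          (placeForm (Matrix.of fun i j : Fin 3 => if i.val + j.val + 1 = 3 then (1 : L) else 0) w.1) | t₀ • x = x} : ℚ) =
        Flicker1998.phiOne (Ideal.absNorm v.asIdeal) N₁ N) :
    ((∑ r ∈ Finset.range 3, {q : (cmDatum L 3 H').Local v ⧸ cmLocalIntegralLevel L 3 H' v |
        q ∈ MulAction.fixedBy ((cmDatum L 3 H').Local v ⧸ cmLocalIntegralLevel L 3 H' v) t ∧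
          (redMat ((((q.out⁻¹ * t * q.out : (cmDatum L 3 H').Local v)).val : GL (Fin 3) (LocalRing L v)).val.map
            (Pi.evalRingHom (fun w' : PlacesOver L v => w'.1.adicCompletion L) w)) - 1).rank = r}.ncard : ℕ) : ℚ) =
      Flicker1998.phiOne (Ideal.absNorm v.asIdeal) Q₁ P := by
  have hc1 : IsCMField.complexConj L ≠ 1 := IsCMField.complexConj_ne_one L
  -- `𝒪_w` is `𝔪`-adically complete (★ p842102)
  haveI : IsAdicComplete (IsLocalRing.maximalIdeal (Valued.integer (w.1.adicCompletion L))) (Valued.integer (w.1.adicCompletion L)) :=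
    isAdicComplete_maximalIdeal_valuedInteger_adicCompletion L w.1
  haveI : Algebra.IsQuadraticExtension ↥(maximalRealSubfield L) L := IsCMField.isQuadraticExtension L
  -- (1) regularity, compact centraliser, deepness (★ p851796, no `2e = 1`)
  have hH'c : (H'.map (cmConjRingHom L))ᵀ = H' := by
    have e1 : H'.map (cmConjRingHom L) = H'.map (IsCMField.complexConj L) := by
      ext i j; simp [Matrix.map_apply, cmConjRingHom_apply]
    rw [e1]; exact hH'
  have hdet : H'.det ≠ 0 := (Matrix.isUnit_iff_isUnit_det _ |>.1 hH'u).ne_zero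
  have hreg : IsRegularElt (t.val : GL (Fin 3) (LocalRing L v)) :=
    isRegularElt_of_congr_traceTorusEltPi L H' w hw hb hππ h₁₂ h₂₃ h₁₃ Tl ψ t hψ hlit
  haveI : CompactSpace (Subgroup.centralizer ({t} : Set ((cmDatum L 3 H').Local v))) :=
    compactSpace_centralizer_of_congr_traceTorusEltPi L H' hH' hH'u w hw hb hππ hx₁ hx₂ hx₃ h₁₂ h₂₃ h₁₃ Tl ψ t hψ hlit
  have ht := deep_of_congr_traceTorusEltPi L H' w hb hππ Tl ψ t hψ hlit hd₁ hd₂ hd₃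
  -- (2) the strata exhaust the fixed cosets (★ O8b)
  have hpart : ∑ r ∈ Finset.range 3, {q : (cmDatum L 3 H').Local v ⧸ cmLocalIntegralLevel L 3 H' v |
        q ∈ MulAction.fixedBy ((cmDatum L 3 H').Local v ⧸ cmLocalIntegralLevel L 3 H' v) t ∧
          (redMat ((((q.out⁻¹ * t * q.out : (cmDatum L 3 H').Local v)).val : GL (Fin 3) (LocalRing L v)).val.map
            (Pi.evalRingHom (fun w' : PlacesOver L v => w'.1.adicCompletion L) w)) - 1).rank = r}.ncard =
      (MulAction.fixedBy ((cmDatum L 3 H').Local v ⧸ cmLocalIntegralLevel L 3 H' v) t).ncard :=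
    sum_range_ncard_strata_eq_ncard_fixedBy t (cmLocalIntegralLevel L 3 H' v)
      (isCompact_isOpen_cmLocalIntegralLevel L 3 H' v).2 (isCompact_isOpen_cmLocalIntegralLevel L 3 H' v).1
      (isClosed_conjClass_local_of_isRegularElt L 3 H' v hH'c hdet t hreg)
      {k | (redMat (((k.val : GL (Fin 3) (LocalRing L v)).val.map (Pi.evalRingHom (fun w' : PlacesOver L v => w'.1.adicCompletion L) w))) - 1) ^ 3 = 0}
      (fun k => (redMat (((k.val : GL (Fin 3) (LocalRing L v)).val.map (Pi.evalRingHom (fun w' : PlacesOver L v => w'.1.adicCompletion L) w))) - 1).rank) 3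
      (fun k _ hkU => rank_lt_of_isNilpotent ⟨3, hkU⟩ (by norm_num)) (fun x hx => redMat_sub_one_pow_eq_zero_of_deep L 3 H' v w hw t ht x hx)
  rw [hpart, ← Nat.card_coe_set_eq, natCard_fixedBy_cmLocalIntegralLevel_eq_of_congr L H' w hw ψ hlev t]
  -- (3) the data at `w` (no `|2|_w = 1`: only the trace element `b_w` and the literal's scalars)
  have hσw : ∀ z : LocalRing L v, conjLocal L (IsCMField.complexConj L) v z w = galAdicCompletionMap (L := L) (IsCMField.complexConj L) hw (z w) :=
    fun z => conjLocal_apply_eq_of_smul_eq (IsCMField.complexConj L) hc1 v w hw z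
  have hbw : b w + galAdicCompletionMap (L := L) (IsCMField.complexConj L) hw (b w) = 1 := by
    rw [← hσw]; have := congrFun hb w; simpa using this
  have hbδw : Valued.v (galAdicCompletionMap (L := L) (IsCMField.complexConj L) hw (b w) - b w) = 1 := by
    have := hbδ; rwa [Pi.sub_apply, hσw] at this
  have hx₁w : galAdicCompletionMap (L := L) (IsCMField.complexConj L) hw (x₁ w) * x₁ w = 1 := by
    rw [← hσw]; exact (congrFun hx₁ w : _)
  have hx₂w : galAdicCompletionMap (L := L) (IsCMField.complexConj L) hw (x₂ w) * x₂ w = 1 := by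
    rw [← hσw]; exact (congrFun hx₂ w : _)
  have hx₃w : galAdicCompletionMap (L := L) (IsCMField.complexConj L) hw (x₃ w) * x₃ w = 1 := by
    rw [← hσw]; exact (congrFun hx₃ w : _)
  have hσπw : galAdicCompletionMap (L := L) (IsCMField.complexConj L) hw (π w) = π w := by
    rw [← hσw]; exact (congrFun hσπ w : _)
  have hππw : π w * π' w = 1 := by
    have := congrFun hππ w; simpa using this
  have hπNw : ∀ z : w.1.adicCompletion L, galAdicCompletionMap (L := L) (IsCMField.complexConj L) hw z * z ≠ π w := by
    intro z hz
    haveI : Subsingleton (PlacesOver L v) := PlacesOver.subsingleton_of_smul_eq (IsCMField.complexConj L) hc1 w hw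
    letI : Unique (PlacesOver L v) := uniqueOfSubsingleton w
    let πe : LocalRing L v ≃+* w.1.adicCompletion L := RingEquiv.piUnique fun w' : PlacesOver L v => w'.1.adicCompletion L
    have hz' : πe.symm z w = z := πe.apply_symm_apply z
    refine hπN (πe.symm z) (πe.injective ?_)
    show (conjLocal L (IsCMField.complexConj L) v (πe.symm z) * πe.symm z) w = π w
    rw [Pi.mul_apply, hσw, hz', hz]
  -- the trace literal read at `w`
  have hte0 : (((localNonsplitEquiv (IsCMField.complexConj L) (Matrix.of fun i j : Fin 3 => if i.val + j.val + 1 = 3 then (1 : L) else 0) hc1 w hw (ψ t) :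
        unitaryGroupOfForm (galAdicCompletionMap (L := L) (IsCMField.complexConj L) hw)
          (placeForm (Matrix.of fun i j : Fin 3 => if i.val + j.val + 1 = 3 then (1 : L) else 0) w.1)) :
        GL (Fin 3) (w.1.adicCompletion L)) : Matrix (Fin 3) (Fin 3) (w.1.adicCompletion L)) =
      !![x₁ w * conjLocal L (IsCMField.complexConj L) v b w + x₃ w * b w, 0, π w * (x₁ w - x₃ w); 0, x₂ w, 0;
        π' w * (b w * conjLocal L (IsCMField.complexConj L) v b w * (x₁ w - x₃ w)), 0, x₁ w * b w + x₃ w * conjLocal L (IsCMField.complexConj L) v b w] := by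
    rw [coe_coe_localNonsplitEquiv_apply, hlit]
    ext i j
    fin_cases i <;> fin_cases j <;> rfl
  have hte : (((localNonsplitEquiv (IsCMField.complexConj L) (Matrix.of fun i j : Fin 3 => if i.val + j.val + 1 = 3 then (1 : L) else 0) hc1 w hw (ψ t) :
        unitaryGroupOfForm (galAdicCompletionMap (L := L) (IsCMField.complexConj L) hw)
          (placeForm (Matrix.of fun i j : Fin 3 => if i.val + j.val + 1 = 3 then (1 : L) else 0) w.1)) :
        GL (Fin 3) (w.1.adicCompletion L)) : Matrix (Fin 3) (Fin 3) (w.1.adicCompletion L)) =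
      !![x₁ w * galAdicCompletionMap (L := L) (IsCMField.complexConj L) hw (b w) + x₃ w * b w, 0, π w * (x₁ w - x₃ w); 0, x₂ w, 0;
        π' w * (b w * galAdicCompletionMap (L := L) (IsCMField.complexConj L) hw (b w) * (x₁ w - x₃ w)), 0,
        x₁ w * b w + x₃ w * galAdicCompletionMap (L := L) (IsCMField.complexConj L) hw (b w)] := by
    rw [hte0, hσw b]
  -- finiteness of the fixed cosets (elliptic regular `t`)
  have hfinG : (MulAction.fixedBy ((cmDatum L 3 H').Local v ⧸ cmLocalIntegralLevel L 3 H' v) t).Finite :=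
    finite_fixedBy_quotient_of_isClosed t (cmLocalIntegralLevel L 3 H' v) (isClosed_conjClass_local_of_isRegularElt L 3 H' v hH'c hdet t hreg)
      (isCompact_isOpen_cmLocalIntegralLevel L 3 H' v).2 (isCompact_isOpen_cmLocalIntegralLevel L 3 H' v).1
  have hfin := (finite_fixedBy_cmLocalIntegralLevel_iff_of_congr L H' w hw ψ hlev t).1 hfinG
  -- (4) the θ̄ = 1 count at `L_w` (the (C5)′ EXPORT)
  exact hX₁ hbw hbv hbδw hx₁w hx₂w hx₃w hσπw hππw hπNw hte hP hQ₁ hQ₂ hfin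

end ThetaOne

/-! ## §2 The unit row at a θ̄ = 0 trace literal `t_1^{(b)}(x₁, x₂, x₃)` -/

section ThetaZero

variable (L : Type) [Field L] [NumberField L] [IsCMField L] (H' : Matrix (Fin 3) (Fin 3) L)
  {v : HeightOneSpectrum (𝓞 ↥(maximalRealSubfield L))}

set_option synthInstance.maxHeartbeats 200000 in  -- the coset action `U_w ↷ U_w ⧸ unitaryInt` (as in ★ `FixedCosetsTransport`)
open scoped Classical in
/-- **THE UNIT ROW AT A θ̄ = 0 TRACE LITERAL (measure-free)**: for `t ∈ G′_v` congruent to `t_1^{(b)}(x₁,x₂,x₃)` (`b + σb = 1`, `|b_w| ≤ 1`) with `x_i` pairwise distinct of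
norm one and ≡ 1 (mod 𝔪_w), `P = ord_w(x₁ − x₃)`, `Q₁ = ord_w(x₁ − x₂)`, `Q₂ = ord_w(x₃ − x₂)` in the trichotomy: the three residually-unipotent Jordan strata of `Fix_t(G′_v ⧸ K_v)`
exhaust it and `n₀(t) + n₁(t) + n₂(t) = #Fix_t = φ₀(Q₁, Q₂, P)` (the (C5)′ EXPORT `natCard_fixedPoints_unitaryInt_traceTorus_eq_phiZero_adicCompletion`, here the
HYPOTHESIS `hX₀` — variant (A)) — twin of ★
`sum_ncard_rankStrata_eq_phiZero_of_congr` with `h2`, `h2e`, `hy` DELETED (CENSUS-LAYERB-3of3 4277d501 §3; CENSUS-C6 196c9bc3 row «UnitRow :497»).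
[cite: Flicker1998UnitaryFL, Prop. 14 p. 94; §6 p. 95] [cite: Rogawski1990, §4.9 Prop. 4.9.1 (b) p. 55] [cite: Kottwitz1986, §3] -/
theorem sum_ncard_rankStrata_eq_phiZero_of_congr_traceTorusElt_of_count
    (hH' : (H'.map (IsCMField.complexConj L))ᵀ = H') (hH'u : IsUnit H') (w : PlacesOver L v)
    (hw : IsCMField.complexConj L • w.1 = w.1)
    {b x₁ x₂ x₃ : LocalRing L v} (hb : b + conjLocal L (IsCMField.complexConj L) v b = 1) (hbv : Valued.v (b w) ≤ 1)
    (hbδ : Valued.v ((conjLocal L (IsCMField.complexConj L) v b - b) w) = 1)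
    (hx₁ : conjLocal L (IsCMField.complexConj L) v x₁ * x₁ = 1) (hx₂ : conjLocal L (IsCMField.complexConj L) v x₂ * x₂ = 1)
    (hx₃ : conjLocal L (IsCMField.complexConj L) v x₃ * x₃ = 1) (h₁₂ : x₁ ≠ x₂) (h₂₃ : x₂ ≠ x₃) (h₁₃ : x₁ ≠ x₃)
    (Tl : GL (Fin 3) (LocalRing L v))
    (ψ : ↥(UnitaryGroup.«local» L (IsCMField.complexConj L) 3 H' v) ≃ₜ*
        ↥(UnitaryGroup.«local» L (IsCMField.complexConj L) 3 (Matrix.of fun i j : Fin 3 => if i.val + j.val + 1 = 3 then (1 : L) else 0) v))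
    (t : (cmDatum L 3 H').Local v)
    (hψ : ∀ g, (ψ g).val = Tl * g.val * Tl⁻¹)
    (hlev : ∀ g, g ∈ cmLocalIntegralLevel L 3 H' v ↔
        ψ g ∈ cmLocalIntegralLevel L 3 (Matrix.of fun i j : Fin 3 => if i.val + j.val + 1 = 3 then (1 : L) else 0) v)
    (hlit : (ψ t).val.val = !![x₁ * conjLocal L (IsCMField.complexConj L) v b + x₃ * b, 0, x₁ - x₃; 0, x₂, 0;
      b * conjLocal L (IsCMField.complexConj L) v b * (x₁ - x₃), 0, x₁ * b + x₃ * conjLocal L (IsCMField.complexConj L) v b])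
    {P Q₁ Q₂ : ℕ} (hP : Valued.v (x₁ w - x₃ w) = WithZero.exp (-(P : ℤ))) (hQ₁ : Valued.v (x₁ w - x₂ w) = WithZero.exp (-(Q₁ : ℤ)))
    (hQ₂ : Valued.v (x₃ w - x₂ w) = WithZero.exp (-(Q₂ : ℤ)))
    (htri : (Q₁ = Q₂ ∧ Q₁ ≤ P) ∨ (Q₁ = P ∧ Q₁ ≤ Q₂) ∨ (Q₂ = P ∧ Q₂ ≤ Q₁))
    (hd₁ : Valued.v (x₁ w - 1) < 1) (hd₂ : Valued.v (x₂ w - 1) < 1) (hd₃ : Valued.v (x₃ w - 1) < 1)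
    -- the (C5)′ θ̄ = 0 EXPORT count, carried as a hypothesis ((R-ord) binder order; CENSUS-C5 bd72510a §3 text)
    (hX₀ : ∀ {b₀ : w.1.adicCompletion L}, b₀ + galAdicCompletionMap (L := L) (IsCMField.complexConj L) hw b₀ = 1 → Valued.v b₀ ≤ 1 →
      Valued.v (galAdicCompletionMap (L := L) (IsCMField.complexConj L) hw b₀ - b₀) = 1 →
      ∀ {a₁ a₂ a₃ : w.1.adicCompletion L}, galAdicCompletionMap (L := L) (IsCMField.complexConj L) hw a₁ * a₁ = 1 →
      galAdicCompletionMap (L := L) (IsCMField.complexConj L) hw a₂ * a₂ = 1 → galAdicCompletionMap (L := L) (IsCMField.complexConj L) hw a₃ * a₃ = 1 →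
      ∀ {t₀ : ↥(unitaryGroupOfForm (galAdicCompletionMap (L := L) (IsCMField.complexConj L) hw)
        (placeForm (Matrix.of fun i j : Fin 3 => if i.val + j.val + 1 = 3 then (1 : L) else 0) w.1))},
      ((t₀ : GL (Fin 3) (w.1.adicCompletion L)) : Matrix (Fin 3) (Fin 3) (w.1.adicCompletion L)) =
        !![a₁ * galAdicCompletionMap (L := L) (IsCMField.complexConj L) hw b₀ + a₃ * b₀, 0, a₁ - a₃; 0, a₂, 0;
          b₀ * galAdicCompletionMap (L := L) (IsCMField.complexConj L) hw b₀ * (a₁ - a₃), 0,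
          a₁ * b₀ + a₃ * galAdicCompletionMap (L := L) (IsCMField.complexConj L) hw b₀] →
      ∀ {N N₁ N₂ : ℕ}, Valued.v (a₁ - a₃) = WithZero.exp (-(N : ℤ)) → Valued.v (a₁ - a₂) = WithZero.exp (-(N₁ : ℤ)) →
      Valued.v (a₃ - a₂) = WithZero.exp (-(N₂ : ℤ)) →
      ((N₁ = N₂ ∧ N₁ ≤ N) ∨ (N₁ = N ∧ N₁ ≤ N₂) ∨ (N₂ = N ∧ N₂ ≤ N₁)) →
      {x : ↥(unitaryGroupOfForm (galAdicCompletionMap (L := L) (IsCMField.complexConj L) hw)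
          (placeForm (Matrix.of fun i j : Fin 3 => if i.val + j.val + 1 = 3 then (1 : L) else 0) w.1)) ⧸
        unitaryInt (galAdicCompletionMap (L := L) (IsCMField.complexConj L) hw)
          (placeForm (Matrix.of fun i j : Fin 3 => if i.val + j.val + 1 = 3 then (1 : L) else 0) w.1) | t₀ • x = x}.Finite →
      (Nat.card {x : ↥(unitaryGroupOfForm (galAdicCompletionMap (L := L) (IsCMField.complexConj L) hw)
          (placeForm (Matrix.of fun i j : Fin 3 => if i.val + j.val + 1 = 3 then (1 : L) else 0) w.1)) ⧸
        unitaryInt (galAdicCompletionMap (L := L) (IsCMField.complexConj L) hw)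
          (placeForm (Matrix.of fun i j : Fin 3 => if i.val + j.val + 1 = 3 then (1 : L) else 0) w.1) | t₀ • x = x} : ℚ) =
        Flicker1998.phiZero (Ideal.absNorm v.asIdeal) N₁ N₂ N) :
    ((∑ r ∈ Finset.range 3, {q : (cmDatum L 3 H').Local v ⧸ cmLocalIntegralLevel L 3 H' v |
        q ∈ MulAction.fixedBy ((cmDatum L 3 H').Local v ⧸ cmLocalIntegralLevel L 3 H' v) t ∧
          (redMat ((((q.out⁻¹ * t * q.out : (cmDatum L 3 H').Local v)).val : GL (Fin 3) (LocalRing L v)).val.map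
            (Pi.evalRingHom (fun w' : PlacesOver L v => w'.1.adicCompletion L) w)) - 1).rank = r}.ncard : ℕ) : ℚ) =
      Flicker1998.phiZero (Ideal.absNorm v.asIdeal) Q₁ Q₂ P := by
  have hc1 : IsCMField.complexConj L ≠ 1 := IsCMField.complexConj_ne_one L
  -- `𝒪_w` is `𝔪`-adically complete (★ p842102)
  haveI : IsAdicComplete (IsLocalRing.maximalIdeal (Valued.integer (w.1.adicCompletion L))) (Valued.integer (w.1.adicCompletion L)) :=
    isAdicComplete_maximalIdeal_valuedInteger_adicCompletion L w.1
  haveI : Algebra.IsQuadraticExtension ↥(maximalRealSubfield L) L := IsCMField.isQuadraticExtension L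
  -- (1) regularity, compact centraliser, deepness (★ p851796, no `2e = 1`)
  have hH'c : (H'.map (cmConjRingHom L))ᵀ = H' := by
    have e1 : H'.map (cmConjRingHom L) = H'.map (IsCMField.complexConj L) := by
      ext i j; simp [Matrix.map_apply, cmConjRingHom_apply]
    rw [e1]; exact hH'
  have hdet : H'.det ≠ 0 := (Matrix.isUnit_iff_isUnit_det _ |>.1 hH'u).ne_zero
  have hreg : IsRegularElt (t.val : GL (Fin 3) (LocalRing L v)) :=
    isRegularElt_of_congr_traceTorusElt L H' w hw hb h₁₂ h₂₃ h₁₃ Tl ψ t hψ hlit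
  haveI : CompactSpace (Subgroup.centralizer ({t} : Set ((cmDatum L 3 H').Local v))) :=
    compactSpace_centralizer_of_congr_traceTorusElt L H' hH' hH'u w hw hb hx₁ hx₂ hx₃ h₁₂ h₂₃ h₁₃ Tl ψ t hψ hlit
  have ht := deep_of_congr_traceTorusElt L H' w hb Tl ψ t hψ hlit hd₁ hd₂ hd₃
  -- (2) the strata exhaust the fixed cosets (★ O8b)
  have hpart : ∑ r ∈ Finset.range 3, {q : (cmDatum L 3 H').Local v ⧸ cmLocalIntegralLevel L 3 H' v |
        q ∈ MulAction.fixedBy ((cmDatum L 3 H').Local v ⧸ cmLocalIntegralLevel L 3 H' v) t ∧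
          (redMat ((((q.out⁻¹ * t * q.out : (cmDatum L 3 H').Local v)).val : GL (Fin 3) (LocalRing L v)).val.map
            (Pi.evalRingHom (fun w' : PlacesOver L v => w'.1.adicCompletion L) w)) - 1).rank = r}.ncard =
      (MulAction.fixedBy ((cmDatum L 3 H').Local v ⧸ cmLocalIntegralLevel L 3 H' v) t).ncard :=
    sum_range_ncard_strata_eq_ncard_fixedBy t (cmLocalIntegralLevel L 3 H' v)
      (isCompact_isOpen_cmLocalIntegralLevel L 3 H' v).2 (isCompact_isOpen_cmLocalIntegralLevel L 3 H' v).1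
      (isClosed_conjClass_local_of_isRegularElt L 3 H' v hH'c hdet t hreg)
      {k | (redMat (((k.val : GL (Fin 3) (LocalRing L v)).val.map (Pi.evalRingHom (fun w' : PlacesOver L v => w'.1.adicCompletion L) w))) - 1) ^ 3 = 0}
      (fun k => (redMat (((k.val : GL (Fin 3) (LocalRing L v)).val.map (Pi.evalRingHom (fun w' : PlacesOver L v => w'.1.adicCompletion L) w))) - 1).rank) 3
      (fun k _ hkU => rank_lt_of_isNilpotent ⟨3, hkU⟩ (by norm_num)) (fun x hx => redMat_sub_one_pow_eq_zero_of_deep L 3 H' v w hw t ht x hx)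
  rw [hpart, ← Nat.card_coe_set_eq, natCard_fixedBy_cmLocalIntegralLevel_eq_of_congr L H' w hw ψ hlev t]
  -- (3) the data at `w`
  have hσw : ∀ z : LocalRing L v, conjLocal L (IsCMField.complexConj L) v z w = galAdicCompletionMap (L := L) (IsCMField.complexConj L) hw (z w) :=
    fun z => conjLocal_apply_eq_of_smul_eq (IsCMField.complexConj L) hc1 v w hw z
  have hbw : b w + galAdicCompletionMap (L := L) (IsCMField.complexConj L) hw (b w) = 1 := by
    rw [← hσw]; have := congrFun hb w; simpa using this
  have hbδw : Valued.v (galAdicCompletionMap (L := L) (IsCMField.complexConj L) hw (b w) - b w) = 1 := by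
    have := hbδ; rwa [Pi.sub_apply, hσw] at this
  have hx₁w : galAdicCompletionMap (L := L) (IsCMField.complexConj L) hw (x₁ w) * x₁ w = 1 := by
    rw [← hσw]; exact (congrFun hx₁ w : _)
  have hx₂w : galAdicCompletionMap (L := L) (IsCMField.complexConj L) hw (x₂ w) * x₂ w = 1 := by
    rw [← hσw]; exact (congrFun hx₂ w : _)
  have hx₃w : galAdicCompletionMap (L := L) (IsCMField.complexConj L) hw (x₃ w) * x₃ w = 1 := by
    rw [← hσw]; exact (congrFun hx₃ w : _)
  -- the trace literal read at `w`
  have hte0 : (((localNonsplitEquiv (IsCMField.complexConj L) (Matrix.of fun i j : Fin 3 => if i.val + j.val + 1 = 3 then (1 : L) else 0) hc1 w hw (ψ t) :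
        unitaryGroupOfForm (galAdicCompletionMap (L := L) (IsCMField.complexConj L) hw)
          (placeForm (Matrix.of fun i j : Fin 3 => if i.val + j.val + 1 = 3 then (1 : L) else 0) w.1)) :
        GL (Fin 3) (w.1.adicCompletion L)) : Matrix (Fin 3) (Fin 3) (w.1.adicCompletion L)) =
      !![x₁ w * conjLocal L (IsCMField.complexConj L) v b w + x₃ w * b w, 0, x₁ w - x₃ w; 0, x₂ w, 0;
        b w * conjLocal L (IsCMField.complexConj L) v b w * (x₁ w - x₃ w), 0, x₁ w * b w + x₃ w * conjLocal L (IsCMField.complexConj L) v b w] := by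
    rw [coe_coe_localNonsplitEquiv_apply, hlit]
    ext i j
    fin_cases i <;> fin_cases j <;> rfl
  have hte : (((localNonsplitEquiv (IsCMField.complexConj L) (Matrix.of fun i j : Fin 3 => if i.val + j.val + 1 = 3 then (1 : L) else 0) hc1 w hw (ψ t) :
        unitaryGroupOfForm (galAdicCompletionMap (L := L) (IsCMField.complexConj L) hw)
          (placeForm (Matrix.of fun i j : Fin 3 => if i.val + j.val + 1 = 3 then (1 : L) else 0) w.1)) :
        GL (Fin 3) (w.1.adicCompletion L)) : Matrix (Fin 3) (Fin 3) (w.1.adicCompletion L)) =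
      !![x₁ w * galAdicCompletionMap (L := L) (IsCMField.complexConj L) hw (b w) + x₃ w * b w, 0, x₁ w - x₃ w; 0, x₂ w, 0;
        b w * galAdicCompletionMap (L := L) (IsCMField.complexConj L) hw (b w) * (x₁ w - x₃ w), 0,
        x₁ w * b w + x₃ w * galAdicCompletionMap (L := L) (IsCMField.complexConj L) hw (b w)] := by
    rw [hte0, hσw b]
  -- finiteness of the fixed cosets (elliptic regular `t`)
  have hfinG : (MulAction.fixedBy ((cmDatum L 3 H').Local v ⧸ cmLocalIntegralLevel L 3 H' v) t).Finite :=
    finite_fixedBy_quotient_of_isClosed t (cmLocalIntegralLevel L 3 H' v) (isClosed_conjClass_local_of_isRegularElt L 3 H' v hH'c hdet t hreg)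
      (isCompact_isOpen_cmLocalIntegralLevel L 3 H' v).2 (isCompact_isOpen_cmLocalIntegralLevel L 3 H' v).1
  have hfin := (finite_fixedBy_cmLocalIntegralLevel_iff_of_congr L H' w hw ψ hlev t).1 hfinG
  -- (4) the θ̄ = 0 count at `L_w` (the (C5)′ EXPORT)
  exact hX₀ hbw hbv hbδw hx₁w hx₂w hx₃w hte hP hQ₁ hQ₂ htri hfin

end ThetaZero

end Literature.NumberTheory.Rogawski1990

end
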